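import Summits.ResolutionOfSingularities.ResolutionOfSingularities.Theorems.PurelyInseparableDim4ResConeThreeWeights
import Summits.ResolutionOfSingularities.ResolutionOfSingularities.Theorems.PurelyInseparableDim4ResConeLightPairWeights
import HarnessLib
import HarnessLib.Audit.Tags

/-!
# Purely inseparable four-folds — the SHADE-`4` WEIGHT AUTOMATON at `p = 5` WITHOUT a lightness hypothesis:
# light pair `(1,1)` for ever, or eventually the D∞ classes `(2)`/`(2,1)` for ever with a forced KEEP/HIT pattern,
# and the `(2)`-VISIT DOCK (cell `res-dim4-pi`, K2(p) lane, slice C at `(p,d) = (5,4)`; holder brick W₄)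

[OURS · counted 0 · cell `res-dim4-pi` · K2(p) lane holder res-dim4-p-12 g4 (memo §17, the `(5,4)` twin of brick W p700619).]
Nothing here proves K2(5) (`RidgeBudget.NoAboveFloorTrap 5 5`), `NoIsolatedTrap 5 5` or resolution of singularities in
dimension ≥ 4 / characteristic `p` — NOT proved.  AI kernel work, weaker than expert review.

res-dim4-p-2 g4's `…ResConeLightPairWeights` (slice B, C∞ entry) normalises the weights of a constant-shade-`4` tail at `p = 5`
UNDER the light bound at satellite steps.  For slice C (`e_G ≡ 2`, socket TAIL-D of `…SliceCSocket`) there is no such bound;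
this file runs the same `(r, j, b)` numerics (new weight `|r_k| − 1`, floor `|r_k| ≥ 2`) under the ISOLATION PAIR BOUND
`r_a + r_b ≤ 3` instead — res-dim4-idea-4's weights-only class automaton (`CONFINE-PROOF.md` §4, `d = 4`) made kernel:
* §1 CORE: `apply_le_three`, `eq_two_of_weight_three` (a weight-`3` letter stands alone and is hit at once: the child is `(2)`),
  `degree_le_four`, `two_le_succ` (a letter of weight `≥ 2` is passed on: class H = «some weight `≥ 2`» is absorbing),
  `light_succ₄`, **`weights_dichotomy₄`**: EITHER every `k ≥ k₀` is the LIGHT PAIR `(1,1)` (`|r_k| = 2`, weights `≤ 1`), OR from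
  some `k₁` on every state has a letter of weight `≥ 2`; **`dInf_of_heavy`**: two steps into the heavy branch every state is in
  D∞ = `(2)` ∪ `(2,1)` (one weight-`2` letter, others `≤ 1`, `|r| ∈ {2,3}`); the D∞ pattern `keep_heavy_of_degree_two` (a
  `(2)`-step keeps its heavy letter, the newborn letter weighs `1`), `hit_heavy_of_degree_three` (a `(2,1)`-step hits its heavy
  letter and the newborn one weighs `2`), `not_isSatellite_of_degree_three_three`.
* §2 DRESS on witnessed isolated above-floor `Step0 5` chains with `x^{r₀} ∣ F₀` and constant shade `4` from `k₀` (no `e_G`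
  hypothesis): `four_weights_laws`, **`four_weights_dichotomy`**, **`dInf_pattern`**, and the FT-free **`(2)`-VISIT DOCK
  `no_four_tail_of_degree_two_budget`**: boundedly many `k ≥ k₁` with `|r_k| = 2` is impossible (else `o ≡ 7`,
  `BandLayers.no_isolated_chain_eventually_upper`).
Not here: res-dim4-p-5's passive-free pair tails (`no_pair_tail_four_five`), the light-pair kill (`no_light_pair_tail` needs the
chart letters in the pair), K2(5).

[cite: CossartJannsenSaito2020, Thm. 3.14, Lemma 13.2] [cite: HauserPerlega2019PRIMS, §2 (transform D′ of D)]
bears_on: LADDER-RESOLUTION:D157-DOOR2 (res-dim4-pi · K2(p) · slice C `(5,4)` weights).  Supports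
stmt-ResolutionOfSingularities-16155 (helper).
-/

set_option linter.dupNamespace false -- mandated namespace of this single-conjunct summit

noncomputable section

namespace Summit.ResolutionOfSingularities.ResolutionOfSingularities.Theorems.PIDim4

namespace ResCone

open MvPolynomial Finset
open Literature.AlgebraicGeometry.Resolution
open Literature.AlgebraicGeometry.Resolution.CentreBlowup
open Literature.AlgebraicGeometry.Resolution.Hauser2010
open Literature.AlgebraicGeometry.Resolution.HauserPerlega2019

variable {K : Type} [Field K]

/-! ## 1. Core numerics: the `d = 4`, `p = 5` weight automaton under the pair bound -/

section Core

variable [DecidableEq K] {r : ℕ → Fin 4 →₀ ℕ} {j : ℕ → Fin 4} {b : ℕ → Fin 4 → K} {k₀ : ℕ}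

/-- Every weight is `≤ 3` under the pair bound. [folklore] -/
theorem apply_le_three (hpair : ∀ k, k₀ ≤ k → ∀ i i', i ≠ i' → r k i + r k i' ≤ 3) {k : ℕ} (hk : k₀ ≤ k)
    (i : Fin 4) : r k i ≤ 3 := by
  obtain ⟨i', hi'⟩ : ∃ i' : Fin 4, i' ≠ i := exists_ne i
  have := hpair k hk i i' (Ne.symm hi')
  omega

/-- **A weight-`3` letter is hit at once and the child is `(2)`**: at `k ≥ k₀` with `r_k W = 3`, the letter `W` stands alone
(`|r_k| = 3`), the newborn letter weighs `2`, `W` is charted or translated, and `|r_{k+1}| = 2`. [OURS] [folklore] -/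
theorem eq_two_of_weight_three
    (hlaw : ∀ k, k₀ ≤ k → r (k + 1) = ((r k).filter (fun i => b k i = 0)).update (j k) ((r k).degree - 1))
    (hbj : ∀ k, b k (j k) = 0) (hpair : ∀ k, k₀ ≤ k → ∀ i i', i ≠ i' → r k i + r k i' ≤ 3) {k : ℕ} (hk : k₀ ≤ k)
    {W : Fin 4} (hW : r k W = 3) :
    (r k).degree = 3 ∧ r (k + 1) (j k) = 2 ∧ (j k = W ∨ b k W ≠ 0) ∧ (r (k + 1)).degree = 2 := by
  obtain ⟨hW3, -, hdeg⟩ := eq_three_of_three_le (hpair k hk) hW.ge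
  have hnew : r (k + 1) (j k) = 2 := by rw [apply_succ_self_of_update (hlaw k hk), hdeg]
  have hhit : j k = W ∨ b k W ≠ 0 := by
    by_contra h
    push Not at h
    have hkept : r (k + 1) W = 3 := by rw [apply_succ_kept_of_update (hlaw k hk) h.1 h.2, hW3]
    have := hpair (k + 1) (by omega) (j k) W h.1
    omega
  refine ⟨hdeg, hnew, hhit, le_antisymm ?_ ?_⟩
  · have h := degree_succ_add_le_of_hit' (hlaw k hk) (hbj k) hhit
    omega
  · calc 2 = r (k + 1) (j k) := hnew.symm
      _ ≤ (r (k + 1)).degree := Finsupp.le_degree (j k) (r (k + 1))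

/-- **`|r_k| ≤ 4`**: otherwise the newborn letter would weigh `≥ 4`. [OURS] [folklore] -/
theorem degree_le_four₄
    (hlaw : ∀ k, k₀ ≤ k → r (k + 1) = ((r k).filter (fun i => b k i = 0)).update (j k) ((r k).degree - 1))
    (hpair : ∀ k, k₀ ≤ k → ∀ i i', i ≠ i' → r k i + r k i' ≤ 3) {k : ℕ} (hk : k₀ ≤ k) : (r k).degree ≤ 4 := by
  have h := apply_le_three hpair (k := k + 1) (by omega) (j k)
  rw [apply_succ_self_of_update (hlaw k hk)] at h
  omega

/-- **The heavy class is absorbing**: a letter of weight `≥ 2` at `k ≥ k₀` is followed by one at `k + 1` (weight `3` ⇒ the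
newborn weighs `2`; weight `2` with `|r| = 2` ⇒ kept, since hitting it breaks the floor; weight `2` with `|r| ≥ 3` ⇒ the newborn
weighs `≥ 2`). [OURS] [folklore] -/
theorem two_le_succ
    (hlaw : ∀ k, k₀ ≤ k → r (k + 1) = ((r k).filter (fun i => b k i = 0)).update (j k) ((r k).degree - 1))
    (hbj : ∀ k, b k (j k) = 0) (hfloor : ∀ k, k₀ ≤ k → 2 ≤ (r k).degree) {k : ℕ} (hk : k₀ ≤ k)
    (hheavy : ∃ W, 2 ≤ r k W) : ∃ W, 2 ≤ r (k + 1) W := by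
  obtain ⟨W, hW⟩ := hheavy
  rcases Nat.lt_or_ge (r k).degree 3 with h2 | h3
  · -- `|r_k| = 2`, so `r_k W = 2` is the whole boundary: `W` is kept
    refine ⟨W, ?_⟩
    have hkeep : ¬ (j k = W ∨ b k W ≠ 0) := fun hhit => by
      have h := degree_succ_add_le_of_hit' (hlaw k hk) (hbj k) hhit
      have := hfloor (k + 1) (by omega)
      omega
    push Not at hkeep
    rw [apply_succ_kept_of_update (hlaw k hk) hkeep.1 hkeep.2]
    exact hW
  · exact ⟨j k, by rw [apply_succ_self_of_update (hlaw k hk)]; omega⟩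

/-- Heaviness for ever from the first heavy state. [OURS] [folklore] -/
theorem two_le_from
    (hlaw : ∀ k, k₀ ≤ k → r (k + 1) = ((r k).filter (fun i => b k i = 0)).update (j k) ((r k).degree - 1))
    (hbj : ∀ k, b k (j k) = 0) (hfloor : ∀ k, k₀ ≤ k → 2 ≤ (r k).degree) {k₁ : ℕ} (hk₁ : k₀ ≤ k₁)
    (hheavy : ∃ W, 2 ≤ r k₁ W) : ∀ k, k₁ ≤ k → ∃ W, 2 ≤ r k W := by
  intro k hk
  obtain ⟨n, rfl⟩ := Nat.exists_eq_add_of_le hk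
  induction n with
  | zero => simpa using hheavy
  | succ n ih =>
    have h := two_le_succ hlaw hbj hfloor (k := k₁ + n) (by omega) (ih (Nat.le_add_right _ _))
    simpa only [Nat.add_succ] using h

/-- **THE WEIGHTS DICHOTOMY at `d = 4`** (core form): EITHER every state `k ≥ k₀` is the LIGHT PAIR (`|r_k| = 2`, weights `≤ 1`),
OR from some `k₁ ≥ k₀` on every state has a letter of weight `≥ 2`. [OURS] [folklore] -/
theorem weights_dichotomy₄
    (hlaw : ∀ k, k₀ ≤ k → r (k + 1) = ((r k).filter (fun i => b k i = 0)).update (j k) ((r k).degree - 1))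
    (hbj : ∀ k, b k (j k) = 0) (hfloor : ∀ k, k₀ ≤ k → 2 ≤ (r k).degree) :
    (∀ k, k₀ ≤ k → (∀ i, r k i ≤ 1) ∧ (r k).degree = 2) ∨
    (∃ k₁, k₀ ≤ k₁ ∧ ∀ k, k₁ ≤ k → ∃ W, 2 ≤ r k W) := by
  by_cases hall : ∀ k, k₀ ≤ k → (∀ i, r k i ≤ 1) ∧ (r k).degree = 2
  · exact Or.inl hall
  · right
    push Not at hall
    obtain ⟨k, hk, hbad⟩ := hall
    by_cases hh : ∃ W, 2 ≤ r k W
    · exact ⟨k, hk, two_le_from hlaw hbj hfloor hk hh⟩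
    · push Not at hh
      have h1 : ∀ i, r k i ≤ 1 := fun i => by have := hh i; omega
      have h3 : 3 ≤ (r k).degree := by have := hfloor k hk; have := hbad h1; omega
      refine ⟨k + 1, by omega, two_le_from hlaw hbj hfloor (k₁ := k + 1) (by omega) ⟨j k, ?_⟩⟩
      rw [apply_succ_self_of_update (hlaw k hk)]
      omega

/-- In the heavy branch a configuration with a weight-`2` letter and `|r| = 4` (i.e. `(2,1,1)`) never occurs after the first
step: it would need two kept weight-`1` letters next to a newborn `2`, i.e. a LIGHT parent. [OURS] [folklore] -/
theorem degree_le_three_of_heavy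
    (hlaw : ∀ k, k₀ ≤ k → r (k + 1) = ((r k).filter (fun i => b k i = 0)).update (j k) ((r k).degree - 1))
    (hbj : ∀ k, b k (j k) = 0) (hpair : ∀ k, k₀ ≤ k → ∀ i i', i ≠ i' → r k i + r k i' ≤ 3) {k : ℕ} (hk : k₀ ≤ k)
    (hheavy : ∃ W, 2 ≤ r k W) : (r (k + 1)).degree ≤ 3 := by
  obtain ⟨W, hW⟩ := hheavy
  have hle4 := degree_le_four₄ hlaw hpair hk
  have hWle : r k W ≤ (r k).degree := Finsupp.le_degree W (r k)
  have hnew : r (k + 1) (j k) = (r k).degree - 1 := apply_succ_self_of_update (hlaw k hk)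
  rcases Nat.lt_or_ge (r k).degree 4 with hlt | hge
  · by_cases hhit : j k = W ∨ b k W ≠ 0
    · have h := degree_succ_add_le_of_hit' (hlaw k hk) (hbj k) hhit
      omega
    · push Not at hhit
      have hkept : r (k + 1) W = r k W := apply_succ_kept_of_update (hlaw k hk) hhit.1 hhit.2
      have hp := hpair (k + 1) (by omega) (j k) W hhit.1
      have h := degree_succ_add_le_of_hit' (hlaw k hk) (hbj k) (N := j k) (Or.inl rfl)
      omega
  · -- `|r_k| = 4`: the newborn letter weighs `3` and stands alone at `k + 1`
    have h3 : 3 ≤ r (k + 1) (j k) := by omega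
    exact (eq_three_of_three_le (hpair (k + 1) (by omega)) h3).2.2.le

/-- **D∞ proper**: two steps into the heavy branch every state has exactly one letter of weight `2`, the others `≤ 1`, and
`|r| ∈ {2, 3}` (classes `(2)` and `(2,1)`). [OURS] [folklore] -/
theorem dInf_of_heavy
    (hlaw : ∀ k, k₀ ≤ k → r (k + 1) = ((r k).filter (fun i => b k i = 0)).update (j k) ((r k).degree - 1))
    (hbj : ∀ k, b k (j k) = 0) (hfloor : ∀ k, k₀ ≤ k → 2 ≤ (r k).degree)
    (hpair : ∀ k, k₀ ≤ k → ∀ i i', i ≠ i' → r k i + r k i' ≤ 3) {k₁ : ℕ} (hk₁ : k₀ ≤ k₁)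
    (hheavy : ∀ k, k₁ ≤ k → ∃ W, 2 ≤ r k W) {k : ℕ} (hk : k₁ + 2 ≤ k) :
    (∃ W, r k W = 2 ∧ ∀ i, i ≠ W → r k i ≤ 1) ∧ 2 ≤ (r k).degree ∧ (r k).degree ≤ 3 := by
  have hd1 : (r (k - 1)).degree ≤ 3 := by
    have h := degree_le_three_of_heavy hlaw hbj hpair (k := k - 2) (by omega) (hheavy (k - 2) (by omega))
    rwa [show k - 2 + 1 = k - 1 by omega] at h
  have hd : (r k).degree ≤ 3 := by
    have h := degree_le_three_of_heavy hlaw hbj hpair (k := k - 1) (by omega) (hheavy (k - 1) (by omega))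
    rwa [show k - 1 + 1 = k by omega] at h
  obtain ⟨W, hW⟩ := hheavy k (by omega)
  -- no weight `3` at `k`: it would need `|r_{k-1}| = 4`
  have hW2 : r k W = 2 := by
    have h3 := apply_le_three hpair (k := k) (by omega) W
    rcases Nat.lt_or_ge (r k W) 3 with h | h
    · omega
    · exfalso
      -- the weight-3 letter is the newborn of step `k-1` (a kept letter would have had weight 3 at `k-1`, standing alone,
      -- and would have been hit): so `|r_{k-1}| − 1 = 3`
      have hlawk := hlaw (k - 1) (by omega)
      have hcases := law_apply_of_update hlawk W
      rw [show k - 1 + 1 = k by omega] at hcases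
      by_cases hjW : W = j (k - 1)
      · rw [if_pos hjW] at hcases; omega
      · rw [if_neg hjW] at hcases
        split_ifs at hcases with hbW
        · -- kept with weight 3 at `k - 1`: then it was hit at `k - 1` (`eq_two_of_weight_three`), contradiction
          have hprev : r (k - 1) W = 3 := by omega
          obtain ⟨-, -, hhit, -⟩ := eq_two_of_weight_three hlaw hbj hpair (k := k - 1) (by omega) hprev
          rcases hhit with hh | hh
          · exact hjW hh.symm
          · exact hh hbW
        · omega
  refine ⟨⟨W, hW2, fun i hi => ?_⟩, hfloor k (by omega), hd⟩
  have := hpair k (by omega) i W hi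
  omega

/-- **A `(2)`-step keeps its heavy letter**: at `|r_k| = 2` with `r_k W = 2`, the step neither charts nor translates `W`, so
`r_{k+1} W = 2`, and the newborn letter weighs `1`. [OURS] [folklore] -/
theorem keep_heavy_of_degree_two
    (hlaw : ∀ k, k₀ ≤ k → r (k + 1) = ((r k).filter (fun i => b k i = 0)).update (j k) ((r k).degree - 1))
    (hbj : ∀ k, b k (j k) = 0) (hfloor : ∀ k, k₀ ≤ k → 2 ≤ (r k).degree) {k : ℕ} (hk : k₀ ≤ k)
    (h2 : (r k).degree = 2) {W : Fin 4} (hW : r k W = 2) :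
    j k ≠ W ∧ b k W = 0 ∧ r (k + 1) W = 2 ∧ r (k + 1) (j k) = 1 := by
  have hnot : ¬ (j k = W ∨ b k W ≠ 0) := fun hhit => by
    have h := degree_succ_add_le_of_hit' (hlaw k hk) (hbj k) hhit
    have := hfloor (k + 1) (by omega)
    omega
  push Not at hnot
  refine ⟨hnot.1, hnot.2, ?_, ?_⟩
  · rw [apply_succ_kept_of_update (hlaw k hk) hnot.1 hnot.2, hW]
  · rw [apply_succ_self_of_update (hlaw k hk), h2]

/-- **A `(2,1)`-step hits its heavy letter and founds a new one**: at `|r_k| = 3` with `r_k W = 2`, the newborn letter weighs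
`2`, so the old heavy letter `W` is charted or translated (pair bound). [OURS] [folklore] -/
theorem hit_heavy_of_degree_three
    (hlaw : ∀ k, k₀ ≤ k → r (k + 1) = ((r k).filter (fun i => b k i = 0)).update (j k) ((r k).degree - 1))
    (hpair : ∀ k, k₀ ≤ k → ∀ i i', i ≠ i' → r k i + r k i' ≤ 3) {k : ℕ} (hk : k₀ ≤ k)
    (h3 : (r k).degree = 3) {W : Fin 4} (hW : r k W = 2) :
    (j k = W ∨ b k W ≠ 0) ∧ r (k + 1) (j k) = 2 := by
  have hnew : r (k + 1) (j k) = 2 := by rw [apply_succ_self_of_update (hlaw k hk), h3]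
  refine ⟨?_, hnew⟩
  by_contra h
  push Not at h
  have hkept : r (k + 1) W = 2 := by rw [apply_succ_kept_of_update (hlaw k hk) h.1 h.2, hW]
  exact h.1 (heavy_unique (hpair (k + 1) (by omega)) hnew hkept)

/-- **`(2,1) → (2,1)` steps are FREE**: if `|r_k| = |r_{k+1}| = 3` in the D∞ branch then the letter born at step `k` weighs
`2` at `k + 1` and is hit by step `k + 1`. [OURS] [folklore] -/
theorem not_isSatellite_of_degree_three_three
    (hlaw : ∀ k, k₀ ≤ k → r (k + 1) = ((r k).filter (fun i => b k i = 0)).update (j k) ((r k).degree - 1))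
    (hpair : ∀ k, k₀ ≤ k → ∀ i i', i ≠ i' → r k i + r k i' ≤ 3) {k : ℕ} (hk : k₀ ≤ k)
    (h3 : (r k).degree = 3) (h3' : (r (k + 1)).degree = 3) : ¬ FreeTail.IsSatellite j b k := by
  intro hsat
  have hnew : r (k + 1) (j k) = 2 := by rw [apply_succ_self_of_update (hlaw k hk), h3]
  rcases (hit_heavy_of_degree_three hlaw hpair (k := k + 1) (by omega) h3' hnew).1 with h | h
  · exact hsat.1 h
  · exact h hsat.2

end Core

/-! ## 2. The dress: witnessed isolated above-floor `Step0 5` chains of constant shade `4` -/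

section Chain

variable [DecidableEq K]

/-- The boundary law, floor and pair bound of a witnessed isolated above-floor `Step0 5` chain with `x^{r₀} ∣ F₀` and
constant shade `4` from `k₀` (`o_k = |r_k| + 4`). [OURS · bookkeeping] [folklore] -/
theorem four_weights_laws {c : ℕ → State K} {j : ℕ → Fin 4} {b : ℕ → Fin 4 → K}
    (hc : ∀ k, IsIsolated 5 (c k).F ∧ Step0 5 (c k) (c (k + 1))) (hw : FreeTail.IsWitnessedChain 5 c j b)
    (hr0 : ∀ e ∈ (c 0).F.support, (c 0).r ≤ e) (hfloor : ∀ k, ordZero (c k).F ≠ 5) {k₀ : ℕ}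
    (hshade : ∀ k, k₀ ≤ k → (c k).shade = ((4 : ℕ) : ℕ∞)) :
    (∀ k, k₀ ≤ k → ordZero (c k).F = (((c k).r.degree + 4 : ℕ) : ℕ∞)) ∧
    (∀ k, k₀ ≤ k →
      (c (k + 1)).r = ((c k).r.filter (fun i => b k i = 0)).update (j k) ((c k).r.degree - 1)) ∧
    (∀ k, b k (j k) = 0) ∧ (∀ k, k₀ ≤ k → 2 ≤ (c k).r.degree) ∧
    (∀ k, k₀ ≤ k → ∀ i i', i ≠ i' → (c k).r i + (c k).r i' ≤ 3) := by
  haveI : Fact (Nat.Prime 5) := ⟨by norm_num⟩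
  have hord : ∀ k, k₀ ≤ k → ordZero (c k).F = (((c k).r.degree + 4 : ℕ) : ℕ∞) := by
    intro k hk
    obtain ⟨o, ho, hpo, -, hd⟩ := chain_shade_nat 5 hc hfloor hshade hk
    rw [ho]; congr 1; omega
  refine ⟨hord, fun k hk => ?_, fun k => (hw k).2.1, fun k hk => ?_, fun k _ i i' hii' => ?_⟩
  · rw [(hw k).2.2.2.2, step_r_univ' 5 (j k) (b k) (c k) (hord k hk)]
    congr 1
  · obtain ⟨o, ho, hpo, -, hd⟩ := chain_shade_nat 5 hc hfloor hshade hk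
    omega
  · have h := IsolatedBand.apply_add_apply_le_of_isIsolated (by norm_num) (hc k).1
      (IsolatedBand.isolated_chain_forall_le hc hr0 k) hii'
    omega

/-- **THE SHADE-`4` WEIGHTS DICHOTOMY AT `p = 5`** (no `e_G`, no lightness): along a witnessed isolated above-floor `Step0 5`
chain with `x^{r₀} ∣ F₀` and constant shade `4` from `k₀`, EITHER every `k ≥ k₀` is the LIGHT PAIR (`|r_k| = 2`, weights `≤ 1`,
`o_k = 6`), OR from some `k₁ ≥ k₀` on every state is in D∞ (exactly one weight-`2` letter, the others `≤ 1`, `|r_k| ∈ {2, 3}`).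
[OURS] [cite: CossartJannsenSaito2020, Thm. 3.14] -/
theorem four_weights_dichotomy {c : ℕ → State K} {j : ℕ → Fin 4} {b : ℕ → Fin 4 → K}
    (hc : ∀ k, IsIsolated 5 (c k).F ∧ Step0 5 (c k) (c (k + 1))) (hw : FreeTail.IsWitnessedChain 5 c j b)
    (hr0 : ∀ e ∈ (c 0).F.support, (c 0).r ≤ e) (hfloor : ∀ k, ordZero (c k).F ≠ 5) {k₀ : ℕ}
    (hshade : ∀ k, k₀ ≤ k → (c k).shade = ((4 : ℕ) : ℕ∞)) :
    (∀ k, k₀ ≤ k → (∀ i, (c k).r i ≤ 1) ∧ (c k).r.degree = 2) ∨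
    (∃ k₁, k₀ ≤ k₁ ∧ ∀ k, k₁ ≤ k → (∃ W, (c k).r W = 2 ∧ ∀ i, i ≠ W → (c k).r i ≤ 1) ∧
      (2 ≤ (c k).r.degree ∧ (c k).r.degree ≤ 3)) := by
  obtain ⟨-, hlaw, hbj, hfl, hpair⟩ := four_weights_laws hc hw hr0 hfloor hshade
  rcases weights_dichotomy₄ hlaw hbj hfl with h | ⟨k₁, hk₁, h⟩
  · exact Or.inl h
  · exact Or.inr ⟨k₁ + 2, by omega, fun k hk => dInf_of_heavy hlaw hbj hfl hpair hk₁ h hk⟩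

/-- **THE D∞ STEP PATTERN**: in the heavy branch, a `(2)`-state keeps its heavy letter (newborn weighs `1`), a `(2,1)`-state
hits it (newborn weighs `2`), and two consecutive `(2,1)`-states make a free step. [OURS] [cite: CossartJannsenSaito2020, Thm. 3.14] -/
theorem dInf_pattern {c : ℕ → State K} {j : ℕ → Fin 4} {b : ℕ → Fin 4 → K}
    (hc : ∀ k, IsIsolated 5 (c k).F ∧ Step0 5 (c k) (c (k + 1))) (hw : FreeTail.IsWitnessedChain 5 c j b)
    (hr0 : ∀ e ∈ (c 0).F.support, (c 0).r ≤ e) (hfloor : ∀ k, ordZero (c k).F ≠ 5) {k₀ : ℕ}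
    (hshade : ∀ k, k₀ ≤ k → (c k).shade = ((4 : ℕ) : ℕ∞)) {k : ℕ} (hk : k₀ ≤ k) {W : Fin 4}
    (hW : (c k).r W = 2) :
    ((c k).r.degree = 2 → j k ≠ W ∧ b k W = 0 ∧ (c (k + 1)).r W = 2 ∧ (c (k + 1)).r (j k) = 1) ∧
    ((c k).r.degree = 3 → (j k = W ∨ b k W ≠ 0) ∧ (c (k + 1)).r (j k) = 2) ∧
    ((c k).r.degree = 3 → (c (k + 1)).r.degree = 3 → ¬ FreeTail.IsSatellite j b k) := by
  obtain ⟨-, hlaw, hbj, hfl, hpair⟩ := four_weights_laws hc hw hr0 hfloor hshade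
  exact ⟨fun h2 => keep_heavy_of_degree_two hlaw hbj hfl hk h2 hW,
    fun h3 => hit_heavy_of_degree_three hlaw hpair hk h3 hW,
    fun h3 h3' => not_isSatellite_of_degree_three_three hlaw hpair hk h3 h3'⟩

/-- **THE `(2)`-VISIT DOCK** (FT-free): along a witnessed isolated above-floor `Step0 5` chain with `x^{r₀} ∣ F₀` and constant
shade `4` from `k₀`, the indices `k ≥ k₁` with `|r_k| = 2` (`o_k = 6`) cannot be bounded in number — else `o_k ≥ 7` from some
index on, excluded by `BandLayers.no_isolated_chain_eventually_upper`. [OURS] [cite: CossartJannsenSaito2020, Thm. 3.14] -/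
theorem no_four_tail_of_degree_two_budget [CharP K 5] {c : ℕ → State K} {j : ℕ → Fin 4} {b : ℕ → Fin 4 → K}
    (hc : ∀ k, IsIsolated 5 (c k).F ∧ Step0 5 (c k) (c (k + 1))) (hw : FreeTail.IsWitnessedChain 5 c j b)
    (hr0 : ∀ e ∈ (c 0).F.support, (c 0).r ≤ e) (hfloor : ∀ k, ordZero (c k).F ≠ 5) {k₀ : ℕ}
    (hshade : ∀ k, k₀ ≤ k → (c k).shade = ((4 : ℕ) : ℕ∞)) {k₁ : ℕ} (hk₁ : k₀ ≤ k₁) {B : ℕ}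
    (hbudget : ∀ n, ((Finset.range n).filter (fun i => (c (k₁ + i)).r.degree = 2)).card ≤ B) : False := by
  haveI : Fact (Nat.Prime 5) := ⟨by norm_num⟩
  classical
  obtain ⟨hord, hlaw, hbj, hfl, hpair⟩ := four_weights_laws hc hw hr0 hfloor hshade
  have hev : ∃ k₂, k₁ ≤ k₂ ∧ ∀ k, k₂ ≤ k → (c k).r.degree ≠ 2 := by
    by_contra hno
    push Not at hno
    have hgrow : ∀ m, ∃ n, m ≤ ((Finset.range n).filter (fun i => (c (k₁ + i)).r.degree = 2)).card := by
      intro m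
      induction m with
      | zero => exact ⟨0, Nat.zero_le _⟩
      | succ m ih =>
        obtain ⟨n, hn⟩ := ih
        obtain ⟨k, hk, h2⟩ := hno (k₁ + n) (by omega)
        refine ⟨k - k₁ + 1, ?_⟩
        have hsub : (Finset.range n).filter (fun i => (c (k₁ + i)).r.degree = 2) ⊆
            (Finset.range (k - k₁ + 1)).filter (fun i => (c (k₁ + i)).r.degree = 2) := by
          intro i hi
          simp only [Finset.mem_filter, Finset.mem_range] at hi ⊢
          exact ⟨by omega, hi.2⟩
        have hmem : k - k₁ ∈ (Finset.range (k - k₁ + 1)).filter (fun i => (c (k₁ + i)).r.degree = 2) := by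
          simp only [Finset.mem_filter, Finset.mem_range]
          exact ⟨by omega, by rwa [show k₁ + (k - k₁) = k by omega]⟩
        have hnot : k - k₁ ∉ (Finset.range n).filter (fun i => (c (k₁ + i)).r.degree = 2) := by
          simp only [Finset.mem_filter, Finset.mem_range, not_and]
          intro h; omega
        have := Finset.card_lt_card ⟨hsub, fun h => hnot (h hmem)⟩
        omega
    obtain ⟨n, hn⟩ := hgrow (B + 1)
    have := hbudget n
    omega
  obtain ⟨k₂, hk₂, hne⟩ := hev
  refine BandLayers.no_isolated_chain_eventually_upper 5 hc (k₀ := k₂) fun k hk => ?_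
  have h3 : 3 ≤ (c k).r.degree := by have := hfl k (by omega); have := hne k hk; omega
  rw [hord k (by omega)]
  exact_mod_cast (by omega)

end Chain

end ResCone

end Summit.ResolutionOfSingularities.ResolutionOfSingularities.Theorems.PIDim4

end
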